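import Literature.AnabelianGeometry.SemiGraphs.TemperedPiVerticialLevelData
import Literature.AnabelianGeometry.SemiGraphs.TemperedVerticialInjective
import Literature.AnabelianGeometry.SemiGraphs.TemperedPiSystemSurj
import Literature.AnabelianGeometry.SemiGraphs.ThetaRayGraph
import HarnessLib

/-!
# The separating character of `π₁^temp(𝒢_θ)` (REFUTE-F1732, brick R6c (c3))

Mochizuki, *Semi-graphs of anabelioids*, Publ. RIMS **42** (2006) [MochizukiSemiAnbd2006], §3,
Prop. 3.6 (ii) p. 38 ("natural equivalence of categories `B^temp(π₁^temp(𝒢)) ⥲ B^temp(𝒢)`") and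
Thm. 3.7 (i) p. 40 (the verticial subgroups) [cite: MochizukiSemiAnbd2006, Prop 3.6(ii) p.38].

PROOF-ONLY file (abc-iut-L3-d4; FRONTIER programme REFUTE-F1732, plan/L3/SUBDAG-SemiAnbd-Thm37iii-REFUTE.md,
brick R6c (c3); honest framing α59: towards a kernel erratum for the ∀-countable reading of [SemiAnbd]
Thm 3.7 (iii); desk countermodel `𝒢_θ` of abc-iut-L3-d1, memo COUNTERMODEL-Thm37iii-infinite.md (2b)/(2c):
"the character `χ : Π → ℤ_p` (at every vertex `a ↦ 1`, `b ↦ 0`) is compatible with both gluings").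
For the ray semi-graph of anabelioids `𝒢 := thetaRay G E up low` (brick R3) with its canonical chart and
Galois tower `D := 𝒢.galoisLevelData h36`, and a continuous character `χG : G → A` to a FINITE DISCRETE
abelian group that is COMPATIBLE WITH THE GLUINGS (`χG ∘ low k = χG ∘ up`), there is a character
`χ : π₁^temp(𝒢) →* A` with

* `χ ∘ P.decompHom = χG` for every compatible point sequence `P` over any vertex (so `χ` restricts to
  `χG` along every verticial homomorphism of the canonical chart, `exists_pointSeq_of_isVerticialHom`);
* `χ` kills the kernel of some level projection `ρ_{j₁}` (hence of every deeper one), so it descends to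
  LEVEL characters `χ_j : Gal(𝒢_{∞,j}/𝒢) →* A`, `χ_j ∘ ρ_j = χ`, for `j ≥ j₁`

(`thetaRay_exists_character`, `thetaRay_exists_levelCharacter`) — the `hχ`/`hσ` producers of
`SemiGraph.ray_not_critical_of_characters` (p437320).  CONSTRUCTION (inside the proofs, no definitions):
the `A`-torsor covering `C_A ∈ B^temp(𝒢)` (every constituent the set `A` with `Π_c` acting by
`χ`-translation, identity gluings — legitimate exactly by the compatibility —, tempered because split by
itself), its right translations `τ_a : C_A ⟶ C_A`, and `χ g := g · 1` for the action of `π₁^temp` on the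
fibre functor's value at `C_A` (abc-iut-L3-t9's `piAct`); `χ` is a homomorphism because the action commutes
with the `τ_a` (`piAct_map`), restricts to `χG` by abc-iut-L3-t8's natural isomorphism
`PointSeq.restrictVIso` (`natIso_inv_app_piAct`, `natIso_inv_app_fV`), and factors through `ρ_{levelOf 1}`
(`piAct_eq_self_of_proj_eq_one`).  Nothing here bears on [IUTchIII] Cor. 3.12.
-/

namespace Literature.AnabelianGeometry.SemiGraphs

namespace ProfiniteSemiGraph

open CategoryTheory Topology

section ThetaRayCharacter

variable {G E : Type} [Group G] [TopologicalSpace G] [IsTopologicalGroup G] [CompactSpace G]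
  [TotallyDisconnectedSpace G] [Group E] [TopologicalSpace E] [IsTopologicalGroup E] [CompactSpace E]
  [TotallyDisconnectedSpace E] {up : E →ₜ* G} {low : ℕ → (E →ₜ* G)}
  {A : Type} [CommGroup A] [TopologicalSpace A] [DiscreteTopology A] [Finite A]

/-- **The `A`-torsor covering `C_A` of `𝒢_θ` with its translations** ([SemiAnbd] Def 3.5 (i)(ii) p. 37:
an object of `B^temp(𝒢)`): for a continuous character `χG : G → A` compatible with the gluings there is a
TEMPERED covering `T` of `thetaRay G E up low` all of whose vertex constituents are the `G`-set `A`
(`g · s = χG g * s`) and a family of endomorphisms `τ a : T ⟶ T` acting on every vertex constituent by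
right translation `s ↦ s * a`.  (Constructed, not assumed; packaged existentially to keep this file
proof-only.) [cite: MochizukiSemiAnbd2006, Def 3.5(ii) p.37] -/
theorem thetaRay_exists_torsorCover (χG : G →ₜ* A) (hχA : ∀ (k : ℕ) (t : E), χG (low k t) = χG (up t)) :
    ∃ (T : BTempCat (thetaRay G E up low)) (e : ∀ v : (thetaRay G E up low).graph.Vertex, (T.obj.SV v).obj.V ≃ A)
      (τ : A → (T.obj ⟶ T.obj)),
      (∀ (v : (thetaRay G E up low).graph.Vertex) (g : G) (s : (T.obj.SV v).obj.V),
        e v ((T.obj.SV v).obj.ρ g s) = χG g * e v s) ∧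
      (∀ (a : A) (v : (thetaRay G E up low).graph.Vertex) (s : (T.obj.SV v).obj.V),
        e v (((τ a).fV v).hom.hom s) = e v s * a) := by
  classical
  -- the constituents: `A` with `G` (resp. `E`) acting by `χG`- (resp. `χG ∘ up`-) translation
  let actV : MulAction G A := MulAction.compHom A χG.toMonoidHom
  let actE : MulAction E A := MulAction.compHom A (χG.toMonoidHom.comp up.toMonoidHom)
  have hstabV : ∀ s : A, {g : G | (@Action.ofMulAction G A _ actV).ρ g s = s} = χG ⁻¹' {1} := by
    intro s
    ext g
    simp only [Set.mem_setOf_eq, Set.mem_preimage, Set.mem_singleton_iff]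
    change χG g * s = s ↔ χG g = 1
    exact mul_eq_right
  have hstabE : ∀ s : A, {t : E | (@Action.ofMulAction E A _ actE).ρ t s = s} = (fun t => χG (up t)) ⁻¹' {1} := by
    intro s
    ext t
    simp only [Set.mem_setOf_eq, Set.mem_preimage, Set.mem_singleton_iff]
    change χG (up t) * s = s ↔ χG (up t) = 1
    exact mul_eq_right
  let XV : BTemp G := ⟨@Action.ofMulAction G A _ actV,
    ⟨inferInstanceAs (Countable A), fun s => by
      rw [hstabV s]
      exact (isOpen_discrete _).preimage χG.continuous⟩⟩
  let XE : BTemp E := ⟨@Action.ofMulAction E A _ actE,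
    ⟨inferInstanceAs (Countable A), fun s => by
      rw [hstabE s]
      exact (isOpen_discrete _).preimage (χG.continuous.comp up.continuous)⟩⟩
  -- the identity gluings (legitimate by the compatibility `χG ∘ low k = χG ∘ up`)
  have hglue : ∀ (b : (thetaRay G E up low).graph.Branch) (v : (thetaRay G E up low).graph.Vertex)
      (h : (thetaRay G E up low).graph.abuts b = some v) (t : E) (s : A),
      (Equiv.refl A) (XE.obj.ρ t s) =
        ((BTemp.res ((thetaRay G E up low).brHom b v h)).obj XV).obj.ρ t ((Equiv.refl A) s) := by
    intro b v h t s
    change χG (up t) * s = χG ((thetaRay G E up low).brHom b v h t) * s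
    rw [thetaRay_brHom]
    obtain ⟨k, c⟩ := b
    cases c
    · change χG (up t) * s = χG (low k t) * s
      rw [hχA]
    · rfl
  let CA : CovObj (thetaRay G E up low) :=
    { SV := fun _ => XV
      SE := fun _ => XE
      glue := fun b v h => BTemp.isoOfEquiv (Equiv.refl A) (hglue b v h) }
  -- `C_A` is tempered: split by itself
  have hfin : CA.IsFinite := ⟨fun _ => inferInstanceAs (Finite A), fun _ => inferInstanceAs (Finite A)⟩
  have hne : CA.HasNonemptyFibres := ⟨fun _ => ⟨(1 : A)⟩, fun _ => ⟨(1 : A)⟩⟩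
  have hsplitV : ∀ (x s : A) (g : G), XV.obj.ρ g x = x → XV.obj.ρ g s = s := by
    intro x s g hx
    change χG g * x = x at hx
    change χG g * s = s
    rw [mul_eq_right.mp hx, one_mul]
  have hsplitE : ∀ (x s : A) (t : E), XE.obj.ρ t x = x → XE.obj.ρ t s = s := by
    intro x s t hx
    change χG (up t) * x = x at hx
    change χG (up t) * s = s
    rw [mul_eq_right.mp hx, one_mul]
  have hsplit : ∀ q : CA.Point, CA.SplitsAt CA q := by
    rintro (⟨v, s⟩ | ⟨e, s⟩)
    · exact fun x g hx => hsplitV x s g hx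
    · exact fun x g hx => hsplitE x s g hx
  have htemp : CA.IsTempered := fun _ => ⟨CA, hfin, hne, fun q _ => hsplit q⟩
  -- the right translations
  let τV : A → (XV ⟶ XV) := fun a => ObjectProperty.homMk
    { hom := TypeCat.ofHom fun s : A => s * a
      comm := fun g => by
        apply ConcreteCategory.hom_ext
        intro s
        exact mul_assoc (χG g) (s : A) a }
  let τE : A → (XE ⟶ XE) := fun a => ObjectProperty.homMk
    { hom := TypeCat.ofHom fun s : A => s * a
      comm := fun t => by
        apply ConcreteCategory.hom_ext
        intro s
        exact mul_assoc (χG (up t)) (s : A) a }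
  let τ : A → (CA ⟶ CA) := fun a =>
    { fV := fun _ => τV a
      fE := fun _ => τE a
      comm := fun b v h => by
        apply ObjectProperty.hom_ext
        apply Action.Hom.ext
        apply ConcreteCategory.hom_ext
        intro s
        rfl }
  exact ⟨⟨CA, htemp⟩, fun _ => Equiv.refl A, τ, fun _ _ _ => rfl, fun _ _ _ => rfl⟩

/-- **The separating character** (memo (2b)/(2c); [SemiAnbd] Prop 3.6 (ii) p. 38 + Thm 3.7 (i) p. 40):
for a continuous character `χG : G → A` (finite discrete abelian `A`) compatible with the gluings of
`𝒢_θ = thetaRay G E up low`, there is a character `χ` of `π₁^temp(𝒢_θ)` (canonical chart) restricting to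
`χG` along the decomposition homomorphism of EVERY compatible point sequence, and vanishing on the kernel
of some level projection. [cite: MochizukiSemiAnbd2006, Prop 3.6(ii) p.38] -/
theorem thetaRay_exists_character (h36 : (thetaRay G E up low).Prop36Hypotheses) (χG : G →ₜ* A)
    (hχA : ∀ (k : ℕ) (t : E), χG (low k t) = χG (up t)) :
    ∃ χ : (thetaRay G E up low).temperedPi h36 →* A,
      (∀ (v : (thetaRay G E up low).graph.Vertex)
        (P : ((thetaRay G E up low).galoisLevelData h36).PointSeq h36.isCountable v) (h : G),
        χ (P.decompHom h) = χG h) ∧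
      ∃ j₁ : ℕ, ∀ g : (thetaRay G E up low).temperedPi h36,
        ((thetaRay G E up low).galoisLevelData h36).proj h36.isCountable j₁ g = 1 → χ g = 1 := by
  classical
  obtain ⟨T, e, τ, hρ, hτ⟩ := thetaRay_exists_torsorCover (up := up) (low := low) χG hχA
  -- notation (plain `let`s for readability; `𝒢`, `D`, the base vertex `v₀`)
  let 𝒢 : ProfiniteSemiGraph.{0} := thetaRay G E up low
  let D : GaloisLevelData 𝒢 := 𝒢.galoisLevelData h36
  let v₀ : 𝒢.graph.Vertex := 𝒢.baseVertex h36
  -- the action of `π₁^temp` on the fibre of `T` over the base vertex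
  let act : 𝒢.temperedPi h36 → (T.obj.SV v₀).obj.V → (T.obj.SV v₀).obj.V :=
    D.piAct h36.isCountable T.obj (𝒢.levelOf h36 T) (𝒢.levelOf_spec h36 T)
  let s₀ : (T.obj.SV v₀).obj.V := (e v₀).symm 1
  have hs₀ : e v₀ s₀ = 1 := (e v₀).apply_symm_apply 1
  -- the action commutes with the translations, hence is by translations
  have hcomm : ∀ (a : A) (γ : 𝒢.temperedPi h36) (s : (T.obj.SV v₀).obj.V),
      ((τ a).fV v₀).hom.hom (act γ s) = act γ (((τ a).fV v₀).hom.hom s) := fun a γ s =>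
    D.piAct_map h36.isCountable (τ a) (𝒢.levelOf h36 T) (𝒢.levelOf_spec h36 T) (𝒢.levelOf h36 T)
      (𝒢.levelOf_spec h36 T) γ s
  -- every point is a translate of `s₀`
  have htrans : ∀ s : (T.obj.SV v₀).obj.V, ((τ (e v₀ s)).fV v₀).hom.hom s₀ = s := by
    intro s
    apply (e v₀).injective
    rw [hτ, hs₀, one_mul]
  have hact : ∀ (γ : 𝒢.temperedPi h36) (s : (T.obj.SV v₀).obj.V),
      e v₀ (act γ s) = e v₀ (act γ s₀) * e v₀ s := by
    intro γ s
    conv_lhs => rw [← htrans s, ← hcomm]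
    rw [hτ]
  -- the character
  let χ : 𝒢.temperedPi h36 →* A :=
    { toFun := fun γ => e v₀ (act γ s₀)
      map_one' := by
        have h1 : act 1 s₀ = s₀ :=
          D.piAct_one h36.isCountable T.obj (𝒢.levelOf h36 T) (𝒢.levelOf_spec h36 T) s₀
        change e v₀ (act 1 s₀) = 1
        rw [h1]; exact hs₀
      map_mul' := fun γ δ => by
        have hm : act (γ * δ) s₀ = act γ (act δ s₀) :=
          D.piAct_mul h36.isCountable T.obj (𝒢.levelOf h36 T) (𝒢.levelOf_spec h36 T) γ δ s₀
        change e v₀ (act (γ * δ) s₀) = e v₀ (act γ s₀) * e v₀ (act δ s₀)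
        rw [hm, hact γ (act δ s₀)] }
  refine ⟨χ, fun v P h => ?_, ⟨𝒢.levelOf h36 T s₀, fun g hg => ?_⟩⟩
  · -- restriction along the decomposition homomorphism of a point sequence: t8's natural isomorphism
    let i := P.restrictVIso
    let φ : (T.obj.SV v₀).obj.V → (T.obj.SV v).obj.V := fun s => (i.inv.app T).hom.hom s
    have hφτ : ∀ (a : A) (s : (T.obj.SV v₀).obj.V),
        φ (((τ a).fV _).hom.hom s) = ((τ a).fV v).hom.hom (φ s) := fun a s =>
      natIso_inv_app_fV i (T := T) (T' := T) (τ a) s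
    have hφact : φ (act (P.decompHom h) s₀) = (T.obj.SV v).obj.ρ h (φ s₀) :=
      natIso_inv_app_piAct i T h s₀
    -- read both sides in `A`
    have h1 : e v (φ (act (P.decompHom h) s₀)) = e v (φ s₀) * χ (P.decompHom h) := by
      have : act (P.decompHom h) s₀ = ((τ (e v₀ (act (P.decompHom h) s₀))).fV v₀).hom.hom s₀ :=
        (htrans _).symm
      rw [this, hφτ, hτ]
      rfl
    have h2 : e v (φ (act (P.decompHom h) s₀)) = χG h * e v (φ s₀) := by rw [hφact, hρ]
    rw [h1, mul_comm] at h2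
    exact mul_right_cancel h2
  · -- vanishing on `ker ρ_{levelOf s₀}`
    have h0 : act g s₀ = s₀ :=
      D.piAct_eq_self_of_proj_eq_one h36.isCountable T.obj (𝒢.levelOf h36 T) (𝒢.levelOf_spec h36 T) g s₀ hg
    change e v₀ (act g s₀) = 1
    rw [h0]; exact hs₀

/-- **Level characters** (memo (2c), the "global character `χ_j : Γ_j → ℤ/p^{e_j}`"): the character of
`thetaRay_exists_character` descends to every deep level `Gal(𝒢_{∞,j}/𝒢)` of the canonical tower — the
`χ : Γ →* A` of `SemiGraph.ray_not_critical_of_characters` with its `hχ` at `ψ := P.gal j` (and `hσ` at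
any element through its decomposition). [cite: MochizukiSemiAnbd2006, Prop 3.6(ii) p.38] -/
theorem thetaRay_exists_levelCharacter (h36 : (thetaRay G E up low).Prop36Hypotheses) (χG : G →ₜ* A)
    (hχA : ∀ (k : ℕ) (t : E), χG (low k t) = χG (up t)) :
    ∃ (χ : (thetaRay G E up low).temperedPi h36 →* A) (j₁ : ℕ),
      (∀ (v : (thetaRay G E up low).graph.Vertex)
        (P : ((thetaRay G E up low).galoisLevelData h36).PointSeq h36.isCountable v) (h : G),
        χ (P.decompHom h) = χG h) ∧
      ∀ j, j₁ ≤ j → ∃ χj : ((thetaRay G E up low).galoisLevelData h36).Gal h36.isCountable j →* A,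
        (∀ g, χj (((thetaRay G E up low).galoisLevelData h36).proj h36.isCountable j g) = χ g) ∧
        ∀ (v : (thetaRay G E up low).graph.Vertex)
          (P : ((thetaRay G E up low).galoisLevelData h36).PointSeq h36.isCountable v) (h : G),
          χj (P.gal j h) = χG h := by
  obtain ⟨χ, hχ, j₁, hj₁⟩ := thetaRay_exists_character (up := up) (low := low) h36 χG hχA
  refine ⟨χ, j₁, hχ, fun j hj => ?_⟩
  have hker : (((thetaRay G E up low).galoisLevelData h36).proj h36.isCountable j).ker ≤ χ.ker := by
    intro g hg
    refine (MonoidHom.mem_ker).mpr (hj₁ g ?_)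
    rw [← ((thetaRay G E up low).galoisLevelData h36).mapLE_proj h36.isCountable hj g,
      (MonoidHom.mem_ker).mp hg, map_one]
  refine ⟨(((thetaRay G E up low).galoisLevelData h36).proj h36.isCountable j).liftOfSurjective
      (((thetaRay G E up low).galoisLevelData h36).proj_surjective h36.isCountable j) ⟨χ, hker⟩,
    fun g => ?_, fun v P h => ?_⟩
  · exact (((thetaRay G E up low).galoisLevelData h36).proj h36.isCountable j).liftOfRightInverse_comp_apply
      _ _ ⟨χ, hker⟩ g
  · rw [← P.proj_decompHom j h]
    rw [(((thetaRay G E up low).galoisLevelData h36).proj h36.isCountable j).liftOfRightInverse_comp_apply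
      _ _ ⟨χ, hker⟩]
    exact hχ v P h

end ThetaRayCharacter

end ProfiniteSemiGraph

end Literature.AnabelianGeometry.SemiGraphs
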